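import Literature.Geometry.Lorentzian.MassCapacityRigidityMass
import Literature.Geometry.Lorentzian.MassCapacityRigidityHarmonic
import Literature.Geometry.Manifold.OpenSubmanifoldMFDeriv
import Mathlib.Geometry.Euclidean.Inversion.Basic
import HarnessLib

/-!
# From "conformal to `(ℝ³ ∖ {0}, δ)`, scalar flat, two ends" to the Schwarzschild exterior of
# mass `m = e.admEnergy D` (assembly of the last step of the case of equality of Bray's Thm. 9)

Bray, J. Differential Geom. 59 (2001), §6, proof of Thm. 9, case of equality, last paragraph:
*"Since `(M̄³_Σ, ḡ)` has two ends, it must be conformal to `(ℝ³ ∖ {0}, δ)`, and since it has zero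
scalar curvature, it follows […] that it must be a Schwarzschild metric. Hence, in the case of
equality, `(M³, g)` must be a Schwarzschild manifold outside `Σ`."* The two preceding files prove
the two ingredients of this sentence that are statements about `ℝ³`:
`MassCapacityRigidityHarmonic.lean` (a harmonic `ψ` on `ℝ³ ∖ {0}` with `ψ → a` at infinity and
`|y| ψ → b` at the origin is `a + b/|y|`, so `ḡ = ψ⁴ δ = (a + b/|y|)⁴ δ`) and
`MassCapacityRigidityMass.lean` (an isometry of the outside region `U` onto a Schwarzschild
exterior of *any* mass forces that mass to be `m = e.admEnergy D` in the case of equality). This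
file assembles them with the elementary rescaling `y = a⁻² z` of §1 (12),
`(a + b/|y|)⁴ |dy|² = (1 + ab/|z|)⁴ |dz|²` on `{b/a < |y|} = {ab < |z|}`, into the form consumed
by the conclusion of the named fact `Bray2001_capacity_rigidity` (`MassCapacity.lean`):

* `exists_diffeomorph_exteriorRegion_dilation` — the dilation `y ↦ c • y` (`c > 0`) is a
  diffeomorphism `{r < |y|} ≅ {cr < |z|}` of exterior regions with differential `c • id`;
* `pullbackBilin_smul_innerSL_of_dilation_apply` — it pulls a conformally flat metric `F δ` back to
  `c² (F ∘ (c •)) δ`; `pullbackBilin_schwarzschild_of_dilation` — in particular, with `c = a²`,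
  the Schwarzschild metric `(1 + ab/|z|)⁴ δ` of mass `2ab` back to `(a + b/|y|)⁴ δ`;
* `schwarzschild_conclusion_of_diffeomorph_twoParam` — **if the outside region `U` is isometric
  to `({b/a < |y|}, (a + b/|y|)⁴ δ)`** (`a, b > 0`) then, in the case of equality
  `½ ℰ(∂U, h) = m`, the conclusion of `Bray2001_capacity_rigidity` holds (isometry onto the
  Schwarzschild exterior `{m/2 < |z|}` of mass `m = e.admEnergy D`; in particular `m = 2ab`);
* `schwarzschild_conclusion_of_diffeomorph_harmonic` — **the same with the conformal factor
  given as a harmonic function** `ψ` on `ℝ³ ∖ {0}` with `ψ → a` at infinity and `|y| ψ(y) → b` at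
  the origin (the two asymptotically flat ends), `U ≅ ({b/a < |y|}, ψ⁴ δ)`;
* `IsOutsideOf.schwarzschild_conclusion_of_diffeomorph_harmonic` — the same under the literal
  hypotheses of the fact;
* `tendsto_inversion_nhdsWithin_zero`, `tendsto_norm_mul_of_tendsto_inversion`,
  `eq_const_add_div_norm_of_harmonicOnNhd_of_inversion` — the hypothesis at the origin read in
  the inverted chart `z = y/|y|²` (Mathlib's `EuclideanGeometry.inversion 0 1`), in which the end
  `y → 0` of `ψ⁴ δ` is the end `|z| → ∞` of `(ψ(y)|y|)⁴ |dz|²`: `|z|⁻¹ ψ(z/|z|²) → b` as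
  `|z| → ∞` gives `|y| ψ(y) → b` as `y → 0`.

What remains of the printed proof of the case of equality before this point (the doubling of
`(M_Σ, g)` across the horizon, Thm. 8 for the doubled manifold and the singular positive mass
rigidity of Bray–Finster, which produce the conformal diffeomorphism onto `(ℝ³ ∖ {0}, ψ⁴ δ)` and
identify the image of `U` with `{b/a < |y|}`) is not addressed here. Everything is proved; no
definitions and no named facts are introduced.

## References

* H. L. Bray, *Proof of the Riemannian Penrose inequality using the positive mass theorem*,
  J. Differential Geom. 59 (2001) 177–267 (arXiv:math/9911173): §1 (12); §6 Def. 17, Thm. 9 and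
  the last paragraph of its proof. (key `BrayRPI2001`)
* B. O'Neill, *Semi-Riemannian Geometry*, Academic Press 1983, Ch. 3, Def. 3.9 and p. 58
  (pullbacks). (key `ONeill1983`)
-/

noncomputable section

open Set Filter Function Metric TopologicalSpace Manifold Bundle Bornology InnerProductSpace
open scoped Topology Real Manifold ContDiff RealInnerProductSpace

namespace Literature.Geometry.Lorentzian

open PseudoRiemannianMetric Literature.Geometry.Manifold

/-! ### Dilations of exterior regions -/

/-- **Dilations of exterior regions.** For `c > 0` and `r' = c r`, the dilation `y ↦ c • y` of
`ℝ³` restricts to a diffeomorphism `{r < ‖y‖} ≅ {r' < ‖z‖}` (inverse `z ↦ c⁻¹ • z`; both are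
restrictions of linear maps, smooth into the open submanifolds by
`ContMDiff.subtypeVal_comp_iff`) whose differential is `c • id` (chain rule through the
inclusions, whose differentials are the identity, `OpenSubmanifold.mfderiv_subtype_val`).
[folklore] -/
theorem exists_diffeomorph_exteriorRegion_dilation {c : ℝ} (hc : 0 < c) {r r' : ℝ}
    (h : r' = c * r) :
    ∃ Dil : Diffeomorph (𝓡 3) (𝓡 3) (exteriorRegion r) (exteriorRegion r') ∞,
      (∀ y : exteriorRegion r, ((Dil y : exteriorRegion r') : E3) = c • (y : E3)) ∧
      ∀ (y : exteriorRegion r) (v : E3), mfderiv (𝓡 3) (𝓡 3) Dil y v = c • v := by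
  have hmem : ∀ y : exteriorRegion r, c • (y : E3) ∈ exteriorRegion r' := fun y ↦ by
    rw [mem_exteriorRegion, norm_smul, Real.norm_of_nonneg hc.le, h]
    exact mul_lt_mul_of_pos_left (mem_exteriorRegion.1 y.2) hc
  have hmem' : ∀ z : exteriorRegion r', c⁻¹ • (z : E3) ∈ exteriorRegion r := fun z ↦ by
    rw [mem_exteriorRegion, norm_smul, Real.norm_of_nonneg (inv_pos.2 hc).le,
      lt_inv_mul_iff₀ hc, ← h]
    exact mem_exteriorRegion.1 z.2
  let eqv : exteriorRegion r ≃ exteriorRegion r' :=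
    { toFun := fun y ↦ ⟨c • (y : E3), hmem y⟩
      invFun := fun z ↦ ⟨c⁻¹ • (z : E3), hmem' z⟩
      left_inv := fun y ↦ Subtype.ext (by simp [smul_smul, inv_mul_cancel₀ hc.ne'])
      right_inv := fun z ↦ Subtype.ext (by simp [smul_smul, mul_inv_cancel₀ hc.ne']) }
  have he : ContMDiff (𝓡 3) (𝓡 3) ∞ eqv := by
    rw [← ContMDiff.subtypeVal_comp_iff]
    exact (contDiff_const_smul c).contMDiff.comp contMDiff_subtype_val
  have he' : ContMDiff (𝓡 3) (𝓡 3) ∞ eqv.symm := by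
    rw [← ContMDiff.subtypeVal_comp_iff]
    exact (contDiff_const_smul c⁻¹).contMDiff.comp contMDiff_subtype_val
  let Dil : Diffeomorph (𝓡 3) (𝓡 3) (exteriorRegion r) (exteriorRegion r') ∞ :=
    { toEquiv := eqv, contMDiff_toFun := he, contMDiff_invFun := he' }
  refine ⟨Dil, fun y ↦ rfl, fun y v ↦ ?_⟩
  have hD : MDifferentiableAt (𝓡 3) (𝓡 3) Dil y := Dil.contMDiff.mdifferentiableAt (by simp)
  have hs : MDifferentiableAt (𝓡 3) (𝓡 3) (fun x : E3 ↦ c • x) ((y : exteriorRegion r) : E3) :=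
    ((contDiff_const_smul (n := 1) c).contMDiff).mdifferentiableAt one_ne_zero
  -- `d(val ∘ Dil) = d Dil` and `d((c •) ∘ val) = c • id`
  have h1 : mfderiv (𝓡 3) (𝓡 3) ((Subtype.val : exteriorRegion r' → E3) ∘ Dil) y =
      (ContinuousLinearMap.id ℝ E3).comp (mfderiv (𝓡 3) (𝓡 3) Dil y) := by
    rw [mfderiv_comp y (OpenSubmanifold.mdifferentiableAt_subtype_val _) hD,
      OpenSubmanifold.mfderiv_subtype_val]
    rfl
  have h2 : mfderiv (𝓡 3) (𝓡 3)
      ((fun x : E3 ↦ c • x) ∘ (Subtype.val : exteriorRegion r → E3)) y =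
      (c • ContinuousLinearMap.id ℝ E3).comp (ContinuousLinearMap.id ℝ E3) := by
    rw [mfderiv_comp y hs (OpenSubmanifold.mdifferentiableAt_subtype_val _),
      OpenSubmanifold.mfderiv_subtype_val]
    congr 1
    rw [mfderiv_eq_fderiv]
    exact ((hasFDerivAt_id ((y : exteriorRegion r) : E3)).const_smul c).fderiv
  have hval : (Subtype.val : exteriorRegion r' → E3) ∘ Dil =
      (fun x : E3 ↦ c • x) ∘ (Subtype.val : exteriorRegion r → E3) := rfl
  rw [hval, h2] at h1
  have h3 := DFunLike.congr_fun h1 v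
  exact h3.symm

/-- **Pullback of a conformally flat metric by a dilation**: if `Dil y = c • y` with
`d Dil = c • id`, then `Dil^* (F δ) = c² (F ∘ Dil) δ`, i.e.
`(Dil^* (F δ))_y (v, w) = c² F(c y) ⟨v, w⟩`. O'Neill 1983, Ch. 3, Def. 3.9.
[cite: ONeill1983, Ch. 3, Def. 3.9] -/
theorem pullbackBilin_smul_innerSL_of_dilation_apply {r r' c : ℝ}
    (Dil : Diffeomorph (𝓡 3) (𝓡 3) (exteriorRegion r) (exteriorRegion r') ∞)
    (hDil : ∀ y : exteriorRegion r, ((Dil y : exteriorRegion r') : E3) = c • (y : E3))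
    (hdDil : ∀ (y : exteriorRegion r) (v : E3), mfderiv (𝓡 3) (𝓡 3) Dil y v = c • v)
    (F : E3 → ℝ) (y : exteriorRegion r) (v w : E3) :
    pullbackBilin (I := 𝓡 3) (I' := 𝓡 3) Dil
        (fun z ↦ F (z : E3) • (innerSL ℝ (E := E3) : E3 →L[ℝ] E3 →L[ℝ] ℝ)) y v w =
      c ^ 2 * F (c • (y : E3)) * @inner ℝ E3 _ v w := by
  show F ((Dil y : exteriorRegion r') : E3) *
      @inner ℝ E3 _ (mfderiv (𝓡 3) (𝓡 3) Dil y v) (mfderiv (𝓡 3) (𝓡 3) Dil y w) = _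
  rw [hdDil, hdDil, hDil, real_inner_smul_left, real_inner_smul_right]
  ring

/-- **The rescaling (12)**: with `c = a²` (`a, b > 0`), the dilation `{b/a < ‖y‖} ≅ {r' < ‖z‖}`,
`r' = a² (b/a) = ab = m'/2` for `m' = 2ab`, pulls the Schwarzschild metric
`(1 + m'/(2‖z‖))⁴ δ` of mass `m' = 2ab` back to `(a + b/‖y‖)⁴ δ`:
`a⁴ (1 + ab/(a² ‖y‖))⁴ = (a + b/‖y‖)⁴`. Bray 2001, §1 (12). [cite: BrayRPI2001, §1 (12)] -/
theorem pullbackBilin_schwarzschild_of_dilation {a b r' : ℝ} (ha : 0 < a) (hb : 0 < b)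
    (Dil : Diffeomorph (𝓡 3) (𝓡 3) (exteriorRegion (b / a)) (exteriorRegion r') ∞)
    (hDil : ∀ y : exteriorRegion (b / a), ((Dil y : exteriorRegion r') : E3) = a ^ 2 • (y : E3))
    (hdDil : ∀ (y : exteriorRegion (b / a)) (v : E3), mfderiv (𝓡 3) (𝓡 3) Dil y v = a ^ 2 • v) :
    pullbackBilin (I := 𝓡 3) (I' := 𝓡 3) Dil
        (fun z ↦ (1 + 2 * a * b / (2 * ‖(z : E3)‖)) ^ 4 •
          (innerSL ℝ (E := E3) : E3 →L[ℝ] E3 →L[ℝ] ℝ)) =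
      fun y : exteriorRegion (b / a) ↦
        (a + b / ‖(y : E3)‖) ^ 4 • (innerSL ℝ (E := E3) : E3 →L[ℝ] E3 →L[ℝ] ℝ) := by
  funext y
  ext v w
  have hy : 0 < ‖(y : E3)‖ := (div_pos hb ha).trans (mem_exteriorRegion.1 y.2)
  show (1 + 2 * a * b / (2 * ‖((Dil y : exteriorRegion r') : E3)‖)) ^ 4 *
      @inner ℝ E3 _ (mfderiv (𝓡 3) (𝓡 3) Dil y v) (mfderiv (𝓡 3) (𝓡 3) Dil y w) =
    (a + b / ‖(y : E3)‖) ^ 4 * @inner ℝ E3 _ v w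
  rw [hdDil, hdDil, hDil, real_inner_smul_left, real_inner_smul_right, norm_smul,
    Real.norm_of_nonneg (by positivity : (0 : ℝ) ≤ a ^ 2)]
  field_simp

/-! ### Assembly: the conclusion of `Bray2001_capacity_rigidity` -/

variable {X : Type} [TopologicalSpace X] [ChartedSpace E3 X] [IsManifold (𝓡 3) ∞ X] [T2Space X]
  [SecondCountableTopology X] [LocallyCompactSpace X] [MeasurableSpace X] [BorelSpace X]
  {D : InitialDataSet (𝓡 3) X} [D.metric.HasLeviCivita] {e : AFEnd X} {U : Opens X}

/-- **Isometric to `({b/a < |y|}, (a + b/|y|)⁴ δ)` ⇒ the conclusion of Thm. 9's case of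
equality.** Let `U` be an exterior region of the end `e` (asymptotically flat of some order
`α > 0` in the metric) with `½ ℰ(∂U, h) = m`, `m = e.admEnergy D`, and suppose `U` is isometric to
the outer half `{b/a < ‖y‖}` of the two-ended Schwarzschild manifold
`(ℝ³ ∖ {0}, (a + b/‖y‖)⁴ δ)`, `a, b > 0`. Then `U` is isometric to the Schwarzschild exterior
`({m/2 < ‖z‖}, (1 + m/2‖z‖)⁴ δ)` of mass `m = e.admEnergy D` (and `m = 2ab`): compose with the
dilation `z = a² y` ((12): mass `2ab`) and identify the mass parameter
(`schwarzschild_conclusion_of_exists_mass`). Bray 2001, §6, proof of Thm. 9, last paragraph,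
with §1 (12). [cite: BrayRPI2001, §6 Thm. 9, proof of the case of equality (last paragraph),
with §1 (12)] -/
theorem schwarzschild_conclusion_of_diffeomorph_twoParam {α : ℝ} (hα : 0 < α)
    (hAF : e.IsMetricAsymptoticallyFlat D α) (hU : IsExteriorRegion e U)
    (heq : (horizonCapacity D.h e U).toReal / 2 = e.admEnergy D) {a b : ℝ} (ha : 0 < a)
    (hb : 0 < b) (Ψ : Diffeomorph (𝓡 3) (𝓡 3) U (exteriorRegion (b / a)) ∞)
    (hΨ : ∀ x : U, pullbackBilin (I := 𝓡 3) (I' := 𝓡 3) Ψ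
      (fun y ↦ (a + b / ‖(y : E3)‖) ^ 4 • (innerSL ℝ (E := E3) : E3 →L[ℝ] E3 →L[ℝ] ℝ)) x =
        D.metric.val x.1) :
    ∃ Φ : Diffeomorph (𝓡 3) (𝓡 3) U (exteriorRegion (e.admEnergy D / 2)) ∞,
      ∀ x : U, pullbackBilin (I := 𝓡 3) (I' := 𝓡 3) Φ
        (fun y ↦ (1 + e.admEnergy D / (2 * ‖(y : E3)‖)) ^ 4 •
          (innerSL ℝ (E := E3) : E3 →L[ℝ] E3 →L[ℝ] ℝ)) x = D.metric.val x.1 := by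
  refine schwarzschild_conclusion_of_exists_mass hα hAF hU heq ⟨2 * a * b, by positivity, ?_⟩
  obtain ⟨Dil, hDil, hdDil⟩ := exists_diffeomorph_exteriorRegion_dilation (c := a ^ 2)
    (by positivity) (r := b / a) (r' := 2 * a * b / 2) (by field_simp)
  refine ⟨Ψ.trans Dil, fun x ↦ ?_⟩
  rw [Diffeomorph.coe_trans, pullbackBilin_comp (Dil.mdifferentiable (by simp))
    (Ψ.mdifferentiable (by simp)), pullbackBilin_schwarzschild_of_dilation ha hb Dil hDil hdDil]
  exact hΨ x

/-- **Conformal to the outer half of `(ℝ³ ∖ {0}, δ)` with a harmonic two-ended factor ⇒ the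
conclusion of Thm. 9's case of equality.** As in `schwarzschild_conclusion_of_diffeomorph_twoParam`,
but with the conformal factor given as printed: `U` is isometric to `({b/a < ‖y‖}, ψ⁴ δ)` where
`ψ` is harmonic on `ℝ³ ∖ {0}` (zero scalar curvature of `ψ⁴ δ`) with `ψ → a` as `‖y‖ → ∞` and
`‖y‖ ψ(y) → b` as `y → 0` (`a, b > 0`: the two asymptotically flat ends). Then `ψ = a + b/‖y‖`
(`eq_const_add_div_norm_of_harmonicOnNhd`: "it must be a Schwarzschild metric") and the previous
assembly applies. Bray 2001, §6, proof of Thm. 9, last paragraph. [cite: BrayRPI2001, §6 Thm. 9,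
proof of the case of equality (last paragraph), with §1 (12)] -/
theorem schwarzschild_conclusion_of_diffeomorph_harmonic {α : ℝ} (hα : 0 < α)
    (hAF : e.IsMetricAsymptoticallyFlat D α) (hU : IsExteriorRegion e U)
    (heq : (horizonCapacity D.h e U).toReal / 2 = e.admEnergy D) {ψ : E3 → ℝ}
    (hψ : HarmonicOnNhd ψ ({0}ᶜ : Set E3)) {a b : ℝ} (ha : 0 < a) (hb : 0 < b)
    (hinf : Tendsto ψ (cobounded E3) (𝓝 a))
    (hzero : Tendsto (fun y ↦ ‖y‖ * ψ y) (𝓝[≠] 0) (𝓝 b))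
    (Ψ : Diffeomorph (𝓡 3) (𝓡 3) U (exteriorRegion (b / a)) ∞)
    (hΨ : ∀ x : U, pullbackBilin (I := 𝓡 3) (I' := 𝓡 3) Ψ
      (fun y ↦ ψ (y : E3) ^ 4 • (innerSL ℝ (E := E3) : E3 →L[ℝ] E3 →L[ℝ] ℝ)) x =
        D.metric.val x.1) :
    ∃ Φ : Diffeomorph (𝓡 3) (𝓡 3) U (exteriorRegion (e.admEnergy D / 2)) ∞,
      ∀ x : U, pullbackBilin (I := 𝓡 3) (I' := 𝓡 3) Φ
        (fun y ↦ (1 + e.admEnergy D / (2 * ‖(y : E3)‖)) ^ 4 •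
          (innerSL ℝ (E := E3) : E3 →L[ℝ] E3 →L[ℝ] ℝ)) x = D.metric.val x.1 := by
  have hfac : (fun y : exteriorRegion (b / a) ↦
      ψ (y : E3) ^ 4 • (innerSL ℝ (E := E3) : E3 →L[ℝ] E3 →L[ℝ] ℝ)) =
      fun y : exteriorRegion (b / a) ↦
        (a + b / ‖(y : E3)‖) ^ 4 • (innerSL ℝ (E := E3) : E3 →L[ℝ] E3 →L[ℝ] ℝ) := by
    funext y
    have hy0 : (y : E3) ≠ 0 := by
      intro h0
      have hy := mem_exteriorRegion.1 y.2
      rw [h0, norm_zero] at hy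
      exact absurd hy (not_lt.2 (div_pos hb ha).le)
    rw [eq_const_add_div_norm_of_harmonicOnNhd hψ hinf hzero (y : E3) hy0]
  refine schwarzschild_conclusion_of_diffeomorph_twoParam hα hAF hU heq ha hb Ψ fun x ↦ ?_
  rw [← hfac]
  exact hΨ x

/-- **The same under the literal hypotheses of `Bray2001_capacity_rigidity`** (`IsOutsideOf e U
f' ν'`, of which only `IsExteriorRegion e U` is used; `e.IsAsymptoticallyFlat D 1`, of which only
the metric part is used; the equality `½ ℰ(Σ, g) = m`): if `U` is isometric to
`({b/a < ‖y‖}, ψ⁴ δ)` with `ψ` harmonic on `ℝ³ ∖ {0}`, `ψ → a > 0` at infinity and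
`‖y‖ ψ(y) → b > 0` at the origin, the conclusion of the fact holds. Bray 2001, §6, proof of
Thm. 9, last paragraph. [cite: BrayRPI2001, §6 Thm. 9, proof of the case of equality (last
paragraph), with §1 (12)] -/
theorem IsOutsideOf.schwarzschild_conclusion_of_diffeomorph_harmonic {S' : Type*} {f' : S' → X}
    {ν' : NormalField (𝓡 3) f'} (hU : IsOutsideOf e U f' ν') (hAF : e.IsAsymptoticallyFlat D 1)
    (heq : (horizonCapacity D.h e U).toReal / 2 = e.admEnergy D) {ψ : E3 → ℝ}
    (hψ : HarmonicOnNhd ψ ({0}ᶜ : Set E3)) {a b : ℝ} (ha : 0 < a) (hb : 0 < b)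
    (hinf : Tendsto ψ (cobounded E3) (𝓝 a))
    (hzero : Tendsto (fun y ↦ ‖y‖ * ψ y) (𝓝[≠] 0) (𝓝 b))
    (Ψ : Diffeomorph (𝓡 3) (𝓡 3) U (exteriorRegion (b / a)) ∞)
    (hΨ : ∀ x : U, pullbackBilin (I := 𝓡 3) (I' := 𝓡 3) Ψ
      (fun y ↦ ψ (y : E3) ^ 4 • (innerSL ℝ (E := E3) : E3 →L[ℝ] E3 →L[ℝ] ℝ)) x =
        D.metric.val x.1) :
    ∃ Φ : Diffeomorph (𝓡 3) (𝓡 3) U (exteriorRegion (e.admEnergy D / 2)) ∞,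
      ∀ x : U, pullbackBilin (I := 𝓡 3) (I' := 𝓡 3) Φ
        (fun y ↦ (1 + e.admEnergy D / (2 * ‖(y : E3)‖)) ^ 4 •
          (innerSL ℝ (E := E3) : E3 →L[ℝ] E3 →L[ℝ] ℝ)) x = D.metric.val x.1 :=
  Literature.Geometry.Lorentzian.schwarzschild_conclusion_of_diffeomorph_harmonic one_pos
    hAF.isMetricAsymptoticallyFlat hU.isExteriorRegion heq hψ ha hb hinf hzero Ψ hΨ

/-! ### The behaviour at the origin read through the inversion `y ↦ y/‖y‖²` -/

open EuclideanGeometry in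
/-- The inversion in the unit sphere about the origin sends punctured neighbourhoods of `0` to
neighbourhoods of infinity: `inversion 0 1 y → ∞` in `cobounded E3` as `y → 0`, `y ≠ 0`
(`‖inversion 0 1 y‖ = 1/‖y‖`, `dist_inversion_center`). [folklore] -/
theorem tendsto_inversion_nhdsWithin_zero :
    Tendsto (inversion (0 : E3) 1) (𝓝[≠] 0) (cobounded E3) := by
  rw [← tendsto_norm_atTop_iff_cobounded]
  have h : ∀ y : E3, y ≠ 0 → ‖inversion (0 : E3) 1 y‖ = ‖y‖⁻¹ := fun y _ ↦ by
    have h1 := dist_inversion_center (0 : E3) y 1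
    rw [dist_zero_right, dist_zero_right] at h1
    rw [h1, one_pow, one_div]
  have h2 : Tendsto (fun y : E3 ↦ ‖y‖⁻¹) (𝓝[≠] 0) atTop :=
    tendsto_inv_nhdsGT_zero.comp tendsto_norm_nhdsNE_zero
  refine h2.congr' ?_
  filter_upwards [self_mem_nhdsWithin] with y hy
  exact (h y hy).symm

open EuclideanGeometry in
/-- **The limit at the origin in the inverted chart.** If `‖z‖⁻¹ ψ(z/‖z‖²) → b` as `‖z‖ → ∞`
(i.e. the conformal factor of `ψ⁴ δ` written in the chart `z = y/‖y‖²` of the end at the origin,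
`ψ(y)⁴ |dy|² = (‖z‖⁻¹ ψ(z/‖z‖²))⁴ |dz|²`, tends to `b`), then `‖y‖ ψ(y) → b` as `y → 0`, `y ≠ 0`
(substitute `z = y/‖y‖²`: the inversion is an involution, `inversion_inversion`, with
`‖z‖ = 1/‖y‖`). [folklore] -/
theorem tendsto_norm_mul_of_tendsto_inversion {ψ : E3 → ℝ} {b : ℝ}
    (h : Tendsto (fun z : E3 ↦ ‖z‖⁻¹ * ψ (inversion (0 : E3) 1 z)) (cobounded E3) (𝓝 b)) :
    Tendsto (fun y : E3 ↦ ‖y‖ * ψ y) (𝓝[≠] 0) (𝓝 b) := by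
  refine (h.comp tendsto_inversion_nhdsWithin_zero).congr' ?_
  filter_upwards [self_mem_nhdsWithin] with y hy
  have h1 := dist_inversion_center (0 : E3) y 1
  rw [dist_zero_right, dist_zero_right] at h1
  simp only [Function.comp_apply]
  rw [inversion_inversion _ one_ne_zero, h1, one_pow, one_div, inv_inv]

open EuclideanGeometry in
/-- `eq_const_add_div_norm_of_harmonicOnNhd` with the hypothesis at the origin read in the
inverted chart: a harmonic `ψ` on `ℝ³ ∖ {0}` with `ψ(y) → a` as `‖y‖ → ∞` and
`‖z‖⁻¹ ψ(z/‖z‖²) → b` as `‖z‖ → ∞` is `a + b/‖y‖`. Bray 2001, §6, proof of Thm. 9, last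
paragraph (two asymptotically flat ends, each read in its own chart). [cite: BrayRPI2001, §6
Thm. 9, proof of the case of equality (last paragraph)] -/
theorem eq_const_add_div_norm_of_harmonicOnNhd_of_inversion {ψ : E3 → ℝ}
    (hψ : HarmonicOnNhd ψ ({0}ᶜ : Set E3)) {a b : ℝ} (hinf : Tendsto ψ (cobounded E3) (𝓝 a))
    (hzero : Tendsto (fun z : E3 ↦ ‖z‖⁻¹ * ψ (inversion (0 : E3) 1 z)) (cobounded E3) (𝓝 b)) :
    ∀ y : E3, y ≠ 0 → ψ y = a + b / ‖y‖ :=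
  eq_const_add_div_norm_of_harmonicOnNhd hψ hinf (tendsto_norm_mul_of_tendsto_inversion hzero)

end Literature.Geometry.Lorentzian

end
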